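import Summits.AtomisticToContinuum.Crystallization.Theorems.ThreeConeCertificateSlackRigidityRodDefs
import Mathlib.Analysis.Fourier.FourierTransform
import Mathlib.Analysis.SpecialFunctions.JapaneseBracket
import Mathlib.MeasureTheory.Measure.Haar.NormedSpace
import HarnessLib

/-!
# Regularity of the rod profile — stub `stub_rodProfile` of line `signed-root-silent-field`
(crux `SlackRigidity`, stmt-AtomisticToContinuum-11960, route `ThreeConeCertificate`, lead c2)

For a continuous radial kernel profile `K : ℝ → ℝ` with `|K(r)| ≤ C_K (1+r)⁻⁴` (`r ≥ 0`), the ROD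
PROFILE `c_G(t) = rodProfile a K t = ∫_{ℝ²} K(√(|u|² + t²)) e^{−2πi⟨u,G⟩} du` (`G = rodDual a`, the
planar Fourier transform `𝓕` of Mathlib on `EuclideanSpace ℝ (Fin 2)`) is

* continuous in `t` (dominated convergence: the integrand is dominated by `C_K (1+|u|)⁻⁴`, which is
  integrable on `ℝ²`, `integrable_one_add_norm`), and
* `O((1+|t|)⁻²)`: `‖c_G(t)‖ ≤ ∫ C_K (1 + √(|u|²+t²))⁻⁴ du`; substituting `u = (1+|t|) u'`
  (`Measure.integral_comp_smul_of_nonneg`, Jacobian `(1+|t|)²`) and using the pointwise inequality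
  `(1+|t|)(1+|u'|) ≤ 2 (1 + √((1+|t|)²|u'|² + t²))` gives
  `‖c_G(t)‖ ≤ 16 C_K (∫_{ℝ²} (1+|u|)⁻⁴ du) (1+|t|)⁻²`.

These are exactly the two hypotheses on `c = rodProfile a K` consumed by the 1-D spectral lemma
(`stub_rodLemma`) in the composition `SlackRigidity_of`.  All `[folklore]` (Stein–Weiss,
*Fourier Analysis on Euclidean Spaces*, Ch. I §1: `‖𝓕f‖_∞ ≤ ‖f‖₁`, continuity of parametric integrals).
Nothing about the Fourier slice (`stub_rodSlice`) is proved here.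
-/

noncomputable section

open scoped BigOperators Topology FourierTransform RealInnerProductSpace
open MeasureTheory Filter Set Metric
open Literature.MathematicalPhysics.StatisticalMechanics
open Summit.AtomisticToContinuum.Crystallization.Theorems.SignedRootSilentField
  (E2 rodDual rodPoint rodProfile rodPhase rodProfile_def)

namespace Summit.AtomisticToContinuum.Crystallization.Theorems.SignedRootProfile

/-! ## Elementary pointwise bounds -/

/-- The decay hypothesis at `r = 0` reads `|K 0| ≤ C_K`, so `0 ≤ C_K`. [folklore] -/
theorem ck_nonneg {CK : ℝ} {K : ℝ → ℝ} (hK : ∀ r : ℝ, 0 ≤ r → |K r| ≤ CK / (1 + r) ^ 4) :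
    0 ≤ CK := by
  have h := hK 0 le_rfl
  rw [add_zero, one_pow, div_one] at h
  exact (abs_nonneg _).trans h

/-- `‖u‖ ≤ √(‖u‖² + t²)`: the radius of a point of the section `x₃ = t` dominates its planar part.
[folklore] -/
theorem norm_le_sqrt_normSq_add_sq (u : E2) (t : ℝ) : ‖u‖ ≤ Real.sqrt (‖u‖ ^ 2 + t ^ 2) :=
  Real.le_sqrt_of_sq_le (by nlinarith [sq_nonneg t])

/-- `|t| ≤ √(‖u‖² + t²)`: the radius of a point of the section `x₃ = t` dominates its height.
[folklore] -/
theorem abs_le_sqrt_normSq_add_sq (u : E2) (t : ℝ) : |t| ≤ Real.sqrt (‖u‖ ^ 2 + t ^ 2) :=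
  Real.abs_le_sqrt (by nlinarith [sq_nonneg ‖u‖])

/-- A decay majorant is monotone in the radius: `C_K (1+r)⁻⁴ ≤ C_K (1+s)⁻⁴` for `0 ≤ s ≤ r`
(and `0 ≤ C_K`). [folklore] -/
theorem ck_div_pow_le {CK s r : ℝ} (hCK : 0 ≤ CK) (hs : 0 ≤ s) (hsr : s ≤ r) :
    CK / (1 + r) ^ 4 ≤ CK / (1 + s) ^ 4 := by
  apply div_le_div_of_nonneg_left hCK (by positivity)
  exact pow_le_pow_left₀ (by positivity) (by linarith) 4

/-- Pointwise kernel bound on the section `x₃ = t`: `|K(√(‖u‖²+t²))| ≤ C_K (1+‖u‖)⁻⁴`, uniformly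
in `t`. [folklore] -/
theorem abs_kernel_le {CK : ℝ} {K : ℝ → ℝ} (hK : ∀ r : ℝ, 0 ≤ r → |K r| ≤ CK / (1 + r) ^ 4)
    (u : E2) (t : ℝ) : |K (Real.sqrt (‖u‖ ^ 2 + t ^ 2))| ≤ CK / (1 + ‖u‖) ^ 4 :=
  (hK _ (Real.sqrt_nonneg _)).trans
    (ck_div_pow_le (ck_nonneg hK) (norm_nonneg u) (norm_le_sqrt_normSq_add_sq u t))

/-- The norm of the Fourier integrand of the rod profile is `|K(√(‖u‖²+t²))|` (the character is
unimodular). [folklore] -/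
theorem norm_integrand (a : ℝ) (K : ℝ → ℝ) (t : ℝ) (u : E2) :
    ‖𝐞 (-⟪u, rodDual a⟫) • (K (Real.sqrt (‖u‖ ^ 2 + t ^ 2)) : ℂ)‖ =
      |K (Real.sqrt (‖u‖ ^ 2 + t ^ 2))| := by
  rw [Circle.norm_smul, Complex.norm_real, Real.norm_eq_abs]

/-- The dominating function `u ↦ C (1+‖u‖)⁻⁴` is integrable on `ℝ²` (`2 < 4`,
`integrable_one_add_norm`). [folklore] -/
theorem integrable_const_div_one_add_norm_pow_four (C : ℝ) :
    Integrable (fun u : E2 => C / (1 + ‖u‖) ^ 4) := by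
  have h : Integrable (fun u : E2 => (1 + ‖u‖) ^ (-(4 : ℝ))) (volume : Measure E2) := by
    apply integrable_one_add_norm
    rw [finrank_euclideanSpace_fin]
    norm_num
  refine (h.const_mul C).congr (ae_of_all _ fun u => ?_)
  simp only
  rw [Real.rpow_neg (by positivity), Real.rpow_ofNat, div_eq_mul_inv]

/-! ## The rod profile as a parametric integral; continuity -/

/-- Unfolding `𝓕`: `rodProfile a K t = ∫ u, 𝐞(−⟪u, G⟫) • K(√(‖u‖²+t²)) du`. [folklore] -/
theorem rodProfile_eq_integral (a : ℝ) (K : ℝ → ℝ) (t : ℝ) :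
    rodProfile a K t =
      ∫ u : E2, 𝐞 (-⟪u, rodDual a⟫) • (K (Real.sqrt (‖u‖ ^ 2 + t ^ 2)) : ℂ) := by
  rw [rodProfile_def, Real.fourier_eq]

/-- **Continuity of the rod profile** (dominated convergence): for a continuous kernel with
`|K(r)| ≤ C_K (1+r)⁻⁴`, `t ↦ rodProfile a K t` is continuous. [folklore] -/
theorem continuous_rodProfile (a CK : ℝ) (K : ℝ → ℝ) (hKc : Continuous K)
    (hK : ∀ r : ℝ, 0 ≤ r → |K r| ≤ CK / (1 + r) ^ 4) : Continuous (rodProfile a K) := by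
  have hfun : rodProfile a K = fun t =>
      ∫ u : E2, 𝐞 (-⟪u, rodDual a⟫) • (K (Real.sqrt (‖u‖ ^ 2 + t ^ 2)) : ℂ) :=
    funext fun t => rodProfile_eq_integral a K t
  rw [hfun]
  refine continuous_of_dominated (bound := fun u : E2 => CK / (1 + ‖u‖) ^ 4) ?_ ?_
    (integrable_const_div_one_add_norm_pow_four CK) ?_
  · intro t
    have hc : Continuous fun u : E2 =>
        𝐞 (-⟪u, rodDual a⟫) • (K (Real.sqrt (‖u‖ ^ 2 + t ^ 2)) : ℂ) := by
      fun_prop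
    exact hc.aestronglyMeasurable
  · intro t
    exact ae_of_all _ fun u => by
      rw [norm_integrand]
      exact abs_kernel_le hK u t
  · exact ae_of_all _ fun u => by fun_prop

/-! ## Decay `O((1+|t|)⁻²)` by scaling -/

/-- The scaling inequality: for `R = 1 + |t|`,
`R (1 + ‖u‖) ≤ 2 (1 + √(‖R • u‖² + t²))` (since `√(R²‖u‖² + t²) ≥ max(R‖u‖, |t|)`). [folklore] -/
theorem scale_ineq (t : ℝ) (u : E2) :
    (1 + |t|) * (1 + ‖u‖) ≤ 2 * (1 + Real.sqrt (‖(1 + |t|) • u‖ ^ 2 + t ^ 2)) := by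
  have hR : 0 ≤ 1 + |t| := by positivity
  have h1 : ‖(1 + |t|) • u‖ = (1 + |t|) * ‖u‖ := by
    rw [norm_smul, Real.norm_eq_abs, abs_of_nonneg hR]
  have hs1 : (1 + |t|) * ‖u‖ ≤ Real.sqrt (‖(1 + |t|) • u‖ ^ 2 + t ^ 2) := by
    rw [← h1]
    exact norm_le_sqrt_normSq_add_sq _ _
  have hs2 : |t| ≤ Real.sqrt (‖(1 + |t|) • u‖ ^ 2 + t ^ 2) := abs_le_sqrt_normSq_add_sq _ _
  nlinarith [norm_nonneg u, abs_nonneg t]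

/-- Pointwise bound on the rescaled majorant:
`C_K (1 + √(‖R • u‖² + t²))⁻⁴ ≤ 16 C_K R⁻⁴ (1+‖u‖)⁻⁴` for `R = 1 + |t|`. [folklore] -/
theorem rescaled_bound {CK : ℝ} (hCK : 0 ≤ CK) (t : ℝ) (u : E2) :
    CK / (1 + Real.sqrt (‖(1 + |t|) • u‖ ^ 2 + t ^ 2)) ^ 4 ≤
      16 * CK / (1 + |t|) ^ 4 * (1 / (1 + ‖u‖) ^ 4) := by
  have h := scale_ineq t u
  have hpos : 0 < (1 + |t|) * (1 + ‖u‖) := by positivity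
  have h4 : ((1 + |t|) * (1 + ‖u‖)) ^ 4 ≤
      (2 * (1 + Real.sqrt (‖(1 + |t|) • u‖ ^ 2 + t ^ 2))) ^ 4 :=
    pow_le_pow_left₀ hpos.le h 4
  rw [show 16 * CK / (1 + |t|) ^ 4 * (1 / (1 + ‖u‖) ^ 4) =
      16 * CK / ((1 + |t|) * (1 + ‖u‖)) ^ 4 by rw [mul_pow]; field_simp]
  rw [div_le_div_iff₀ (by positivity) (by positivity)]
  calc CK * ((1 + |t|) * (1 + ‖u‖)) ^ 4
      ≤ CK * (2 * (1 + Real.sqrt (‖(1 + |t|) • u‖ ^ 2 + t ^ 2))) ^ 4 :=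
        mul_le_mul_of_nonneg_left h4 hCK
    _ = 16 * CK * (1 + Real.sqrt (‖(1 + |t|) • u‖ ^ 2 + t ^ 2)) ^ 4 := by ring

/-- **Decay of the rod profile**: `‖rodProfile a K t‖ ≤ 16 C_K (∫_{ℝ²} (1+‖u‖)⁻⁴ du) (1+|t|)⁻²`.
[folklore] -/
theorem norm_rodProfile_le (a CK : ℝ) (K : ℝ → ℝ) (hKc : Continuous K)
    (hK : ∀ r : ℝ, 0 ≤ r → |K r| ≤ CK / (1 + r) ^ 4) (t : ℝ) :
    ‖rodProfile a K t‖ ≤ (16 * CK * ∫ u : E2, 1 / (1 + ‖u‖) ^ 4) / (1 + |t|) ^ 2 := by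
  have hCK := ck_nonneg hK
  have hRpos : 0 < 1 + |t| := by positivity
  -- Step 1: `‖c(t)‖ ≤ ∫ |K(√(‖u‖²+t²))| du`
  have h1 : ‖rodProfile a K t‖ ≤ ∫ u : E2, |K (Real.sqrt (‖u‖ ^ 2 + t ^ 2))| := by
    rw [rodProfile_eq_integral]
    refine (norm_integral_le_integral_norm _).trans (le_of_eq ?_)
    exact integral_congr_ae (ae_of_all _ fun u => norm_integrand a K t u)
  -- Step 2: `≤ ∫ C_K (1 + √(‖u‖²+t²))⁻⁴ du`
  have hg_int : Integrable (fun u : E2 => CK / (1 + Real.sqrt (‖u‖ ^ 2 + t ^ 2)) ^ 4) := by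
    have hc : Continuous fun u : E2 => CK / (1 + Real.sqrt (‖u‖ ^ 2 + t ^ 2)) ^ 4 := by
      refine continuous_const.div (by fun_prop) fun u => ?_
      positivity
    refine (integrable_const_div_one_add_norm_pow_four CK).mono' hc.aestronglyMeasurable
      (ae_of_all _ fun u => ?_)
    rw [Real.norm_eq_abs, abs_of_nonneg (by positivity)]
    exact ck_div_pow_le hCK (norm_nonneg u) (norm_le_sqrt_normSq_add_sq u t)
  have hK_int : Integrable (fun u : E2 => |K (Real.sqrt (‖u‖ ^ 2 + t ^ 2))|) := by
    have hc : Continuous fun u : E2 => |K (Real.sqrt (‖u‖ ^ 2 + t ^ 2))| := by fun_prop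
    refine (integrable_const_div_one_add_norm_pow_four CK).mono' hc.aestronglyMeasurable
      (ae_of_all _ fun u => ?_)
    rw [Real.norm_eq_abs, abs_abs]
    exact abs_kernel_le hK u t
  have h2 : ∫ u : E2, |K (Real.sqrt (‖u‖ ^ 2 + t ^ 2))| ≤
      ∫ u : E2, CK / (1 + Real.sqrt (‖u‖ ^ 2 + t ^ 2)) ^ 4 :=
    integral_mono hK_int hg_int fun u => hK _ (Real.sqrt_nonneg _)
  -- Step 3: scaling `u = (1+|t|) • u'` (Jacobian `(1+|t|)²`)
  have h3 : ∫ u : E2, CK / (1 + Real.sqrt (‖u‖ ^ 2 + t ^ 2)) ^ 4 =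
      (1 + |t|) ^ 2 * ∫ u : E2, CK / (1 + Real.sqrt (‖(1 + |t|) • u‖ ^ 2 + t ^ 2)) ^ 4 := by
    have h := Measure.integral_comp_smul_of_nonneg volume
      (fun u : E2 => CK / (1 + Real.sqrt (‖u‖ ^ 2 + t ^ 2)) ^ 4) (1 + |t|) (hR := hRpos.le)
    rw [h, smul_eq_mul, finrank_euclideanSpace_fin, ← mul_assoc,
      mul_inv_cancel₀ (pow_ne_zero _ hRpos.ne'), one_mul]
  -- Step 4: the rescaled integral is `≤ 16 C_K (1+|t|)⁻⁴ ∫ (1+‖u‖)⁻⁴`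
  have hI : Integrable (fun u : E2 => 1 / (1 + ‖u‖) ^ 4) :=
    integrable_const_div_one_add_norm_pow_four 1
  have h4 : ∫ u : E2, CK / (1 + Real.sqrt (‖(1 + |t|) • u‖ ^ 2 + t ^ 2)) ^ 4 ≤
      ∫ u : E2, 16 * CK / (1 + |t|) ^ 4 * (1 / (1 + ‖u‖) ^ 4) :=
    integral_mono_of_nonneg (ae_of_all _ fun u => by positivity) (hI.const_mul _)
      (ae_of_all _ fun u => rescaled_bound hCK t u)
  rw [integral_const_mul] at h4
  -- combine
  calc ‖rodProfile a K t‖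
      ≤ (1 + |t|) ^ 2 * ∫ u : E2, CK / (1 + Real.sqrt (‖(1 + |t|) • u‖ ^ 2 + t ^ 2)) ^ 4 := by
        rw [← h3]
        exact h1.trans h2
    _ ≤ (1 + |t|) ^ 2 * (16 * CK / (1 + |t|) ^ 4 * ∫ u : E2, 1 / (1 + ‖u‖) ^ 4) :=
        mul_le_mul_of_nonneg_left h4 (by positivity)
    _ = (16 * CK * ∫ u : E2, 1 / (1 + ‖u‖) ^ 4) / (1 + |t|) ^ 2 := by
        field_simp

/-! ## The registered stub -/

/-- **STUB 5b (`stub_rodProfile`) — REGULARITY OF THE ROD PROFILE.**  For a continuous kernel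
`|K(r)| ≤ C_K(1+r)⁻⁴` the rod profile `t ↦ rodProfile a K t = ∫_{ℝ²} K(√(|u|²+t²)) e^{−2πi⟨u,G⟩} du`
is continuous and `O((1+|t|)⁻²)` (with the explicit constant `16 C_K ∫_{ℝ²} (1+|u|)⁻⁴ du`).
Dominated convergence for continuity; for the decay the substitution `u = (1+|t|) u'` and
`(1+|t|)(1+|u'|) ≤ 2 (1 + √((1+|t|)²|u'|² + t²))`. [folklore] -/
theorem stub_rodProfile :
  ∀ (a CK : ℝ) (K : ℝ → ℝ), Continuous K → (∀ r : ℝ, 0 ≤ r → |K r| ≤ CK / (1 + r) ^ 4) →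
    Continuous (rodProfile a K) ∧ ∃ C : ℝ, ∀ t : ℝ, ‖rodProfile a K t‖ ≤ C / (1 + |t|) ^ 2 := by
  intro a CK K hKc hK
  exact ⟨continuous_rodProfile a CK K hKc hK, _, norm_rodProfile_le a CK K hKc hK⟩

end Summit.AtomisticToContinuum.Crystallization.Theorems.SignedRootProfile

end
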